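import Summits.BirchSwinnertonDyer.BirchSwinnertonDyer.Theorems.AlignedTransportAtTwoMainConjectureOfRankZeroBSDAtTwoSelmerLayerJumpShape
import Summits.BirchSwinnertonDyer.BirchSwinnertonDyer.Theorems.AlignedTransportAtTwoMainConjectureOfRankZeroBSDAtTwoSelmerLayerTwoSidedMatching
import HarnessLib

/-!
# Route `AlignedTransportAtTwo`, crux C2 `MainConjectureOfRankZeroBSDAtTwo` (stmt-BirchSwinnertonDyer-22298):
# MULTIPLICITY BOUNDS — `rank_{ℤ_p} X/PX ≤ deg P · ord_P(f_X)`: `rank_{ℤ_p} X/Ψ_{n+1}X ≤ φ(p^{n+1})·e` whenever `Ψ_{n+1}^{e+1} ∤ f_X`;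
# at `p = 2`: `corank Sel_{2^∞}(W⁽²⁾/ℚ) ≤ rank_{ℤ₂} X/(T+2)X ≤ e` whenever `(T+2)^{e+1} ∤ f_X` (the lineage's `j`-bit sandwich)

HONEST FRAMING (cell `bsd-f1-sign2`, WIDTH-5 attached prover seat `bsd-line-att-p5` gen 40 on line `birth` of the lead
`bsd-line-att-p2`; `--supports` stmt-BirchSwinnertonDyer-22298, closes nothing; BSD is NOT proved by any of this; the crux
C2, its verdict «blocked-on `Rank1Residual.GreenbergMuConjectureIrreducible`» and every registered stub are untouched).
THEOREMS ONLY — no `def`, no instance, no named fact, no `sorry`. Corollaries of `…SelmerLayerJumpShape` (`deg P ∣ rank X/PX`,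
`P^t ∣ f_X` for `deg P · t ≤ rank X/PX`):

* ★★ `lambdaInvariant_quotient_le_natDegree_mul_of_not_pow_dvd` — **`rank_{ℤ_p} X/PX ≤ deg P · e` if `P^{e+1} ∤ f_X`** (`P` distinguished,
  prime in `Λ`, irreducible over `ℚ_p`; `char_Λ X = (f_X)`); ★★ `lambdaInvariant_cyclotomicFactor_le_of_not_pow_dvd` (`P = Ψ_{n+1}`);
* ★★ `selmerCorank_layer_succ_sub_le_of_not_pow_dvd_of_finite_kerG` — **the Selmer-corank jump `K_n → K_{n+1}` is `≤ φ(p^{n+1})·e` if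
  `Ψ_{n+1}^{e+1} ∤ f_X`** (mod `ker g_n`, `ker g_{n+1}` finite); unconditional variant for `corank Sel(E_{K_{n+1}}) − rank X/ω_nX`;
* `p = 2`: `coe_cyclotomicLayer_two_zero` (`Ψ_1 = T + 2` in `Λ` at `p = 2`), ★★ `lambdaInvariant_quotient_X_add_two_le_of_not_pow_dvd` —
  **`rank_{ℤ₂} X/(T+2)X ≤ e` if `(T+2)^{e+1} ∤ f_X`**, ★★ `selmerCorank_quadraticTwist_le_of_not_pow_dvd` — **`corank Sel_{2^∞}(W⁽²⁾/ℚ) ≤ e`**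
  then (g38's `(T+2)^{corank} ∣ f_X` recovered through the rank of `X/(T+2)X`, which sits in between).

References: R. Greenberg, LNM 1716 (1999), §1 p. 65, §5 p. 132 [GreenbergLNM1716]; L. Washington, GTM 83, §13.2 [Washington1997];
T. Dokchitser, V. Dokchitser, Ann. of Math. 172 (2010), Lemma 4.14 [DokchitserDokchitserAnnals2010].
-/

set_option linter.dupNamespace false
set_option autoImplicit false

noncomputable section

open scoped Classical AddSubgroup TensorProduct Polynomial

universe u

namespace Summit.BirchSwinnertonDyer.BirchSwinnertonDyer.Theorems.AlignedTransportAtTwoSelmerLayerMultiplicity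

open Polynomial WeierstrassCurve Literature.NumberTheory.EllipticCurves Literature.NumberTheory.EllipticCurves.IwasawaDual
  Summit.BirchSwinnertonDyer.BirchSwinnertonDyer.Theorems.AlignedTransportAtTwoSelmerLayerControl
  Summit.BirchSwinnertonDyer.BirchSwinnertonDyer.Theorems.AlignedTransportAtTwoSelmerLayerSplit
  Summit.BirchSwinnertonDyer.BirchSwinnertonDyer.Theorems.AlignedTransportAtTwoSelmerLayerJumpShape
  Summit.BirchSwinnertonDyer.BirchSwinnertonDyer.Theorems.AlignedTransportAtTwoSelmerLayerTwoSidedMatching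
  Summit.BirchSwinnertonDyer.BirchSwinnertonDyer.Theorems.AlignedTransportAtTwoCyclotomicLayerPrime

/-! ## §1 `rank_{ℤ_p} X/PX ≤ deg P · e` when `P^{e+1} ∤ f_X` -/

section Algebra

variable (p : ℕ) [hp : Fact p.Prime]

/-- ★★ **`rank_{ℤ_p} X/PX ≤ deg P · e` whenever `P^{e+1} ∤ f_X`** (`P ∈ ℤ_p[X]` distinguished, prime in `Λ` and irreducible over `ℚ_p`;
`X` f.g. torsion with `char_Λ X = (f_X)`): `rank X/PX = deg P · t` (`natDegree_dvd_lambdaInvariant_of_coe_smul_eq_zero`) and `P^t ∣ f_X`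
(`coe_pow_dvd_of_mem_charIdeal_of_mul_le_lambdaInvariant`), so `t ≤ e`. In structure-theory terms `rank X/PX = deg P · #{j : f_j = P} ≤
deg P · ∑_{f_j = P} a_j = deg P · ord_P f_X`. [cite: Washington1997, §13.2] [cite: GreenbergLNM1716, §1 p. 65] -/
theorem lambdaInvariant_quotient_le_natDegree_mul_of_not_pow_dvd {P : ℤ_[p][X]}
    (hP : P.IsDistinguishedAt (IsLocalRing.maximalIdeal ℤ_[p])) (hPr : Prime (P : PowerSeries ℤ_[p]))
    (hirr : Irreducible (P.map (algebraMap ℤ_[p] ℚ_[p])))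
    (X : Type u) [AddCommGroup X] [Module (IwasawaAlgebra p) X] [Module.Finite (IwasawaAlgebra p) X]
    (hX : Module.IsTorsion (IwasawaAlgebra p) X) {f : IwasawaAlgebra p} (hf : Module.charIdeal (IwasawaAlgebra p) X = Ideal.span {f})
    {e : ℕ} (he : ¬ (P : PowerSeries ℤ_[p]) ^ (e + 1) ∣ f) :
    lambdaInvariant p (X ⧸ (Ideal.span {(P : PowerSeries ℤ_[p])} • ⊤ : Submodule (IwasawaAlgebra p) X)) ≤ P.natDegree * e := by
  obtain ⟨t, ht⟩ := natDegree_dvd_lambdaInvariant_of_coe_smul_eq_zero p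
    (X ⧸ (Ideal.span {(P : PowerSeries ℤ_[p])} • ⊤ : Submodule (IwasawaAlgebra p) X)) hP.monic hirr (fun q ↦ by
      induction q using Submodule.Quotient.induction_on with
      | H x =>
        rw [← Submodule.Quotient.mk_smul, Submodule.Quotient.mk_eq_zero]
        exact Submodule.smul_mem_smul (Ideal.mem_span_singleton_self _) Submodule.mem_top)
  rw [ht]
  refine Nat.mul_le_mul_left _ (Nat.lt_succ_iff.mp (not_le.mp fun hle ↦ he ?_))
  exact coe_pow_dvd_of_mem_charIdeal_of_mul_le_lambdaInvariant p hP hPr X hX (by rw [ht]; exact Nat.mul_le_mul_left _ hle)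
    (by rw [hf]; exact Ideal.mem_span_singleton_self f)

/-- ★★ **`rank_{ℤ_p} X/Ψ_{n+1}X ≤ φ(p^{n+1}) · e` whenever `Ψ_{n+1}^{e+1} ∤ f_X`** (`X` f.g. torsion, `char_Λ X = (f_X)`).
[cite: Washington1997, §13.2] [cite: GreenbergLNM1716, §5 p. 132] -/
theorem lambdaInvariant_cyclotomicFactor_le_of_not_pow_dvd (X : Type u) [AddCommGroup X] [Module (IwasawaAlgebra p) X]
    [Module.Finite (IwasawaAlgebra p) X] (hX : Module.IsTorsion (IwasawaAlgebra p) X) {f : IwasawaAlgebra p}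
    (hf : Module.charIdeal (IwasawaAlgebra p) X = Ideal.span {f}) (n : ℕ) {e : ℕ}
    (he : ¬ (((cyclotomic (p ^ (n + 1)) ℤ_[p]).comp (Polynomial.X + 1) : ℤ_[p][X]) : PowerSeries ℤ_[p]) ^ (e + 1) ∣ f) :
    lambdaInvariant p (X ⧸ (Ideal.span
      {(∑ i ∈ Finset.range p, ((1 + PowerSeries.X : PowerSeries ℤ_[p]) ^ (p ^ n)) ^ i : IwasawaAlgebra p)} •
        ⊤ : Submodule (IwasawaAlgebra p) X)) ≤ p ^ n * (p - 1) * e := by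
  have hmonic : ((cyclotomic (p ^ (n + 1)) ℤ_[p]).comp (Polynomial.X + 1)).Monic := DefectPrime.monic_cyclotomic_comp _
  have hirr : Irreducible (((cyclotomic (p ^ (n + 1)) ℤ_[p]).comp (Polynomial.X + 1)).map (algebraMap ℤ_[p] ℚ_[p])) :=
    (hmonic.irreducible_iff_irreducible_map_fraction_map).mp (DefectPrime.prime_cyclotomic_comp_polynomial p n).irreducible
  have h := lambdaInvariant_quotient_le_natDegree_mul_of_not_pow_dvd p (DefectPrime.cyclotomic_comp_isDistinguishedAt_maximalIdeal p n)
    (DefectPrime.prime_coe_cyclotomic_comp p n) hirr X hX hf he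
  rw [natDegree_cyclotomicLayer, coe_cyclotomicLayer_eq_sum] at h
  exact h

end Algebra

/-! ## §2 Selmer: the jump is at most `φ(p^{n+1}) · ord_{Ψ_{n+1}} f_X` -/

section Selmer

variable {K : Type u} [Field K] [NumberField K] (W : WeierstrassCurve K) [W.IsElliptic] {p : ℕ} [hp : Fact p.Prime]
  (κ : ZpExtension K p) {γ : Field.absoluteGaloisGroup K}

/-- ★★ **The Selmer-corank jump `K_n → K_{n+1}` is at most `φ(p^{n+1}) · e` whenever `Ψ_{n+1}^{e+1} ∤ f_X`** (mod `ker g_n`, `ker g_{n+1}`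
finite): with `…SelmerLayerJumpShape` the jump is `φ(p^{n+1}) · t`, `t ≤ ord_{Ψ_{n+1}} f_X`. [cite: GreenbergLNM1716, §5 p. 132, Thm 1.2] -/
theorem selmerCorank_layer_succ_sub_le_of_not_pow_dvd_of_finite_kerG (hγ : κ.IsTopGenerator γ) (D : W.SelmerDualData κ γ)
    [Module.Finite (IwasawaAlgebra p) D.X] (hD : D.IsTorsion) {f : IwasawaAlgebra p} (hf : D.charIdeal = Ideal.span {f}) (n : ℕ)
    [Finite (W.KerG κ n)] [Finite (W.KerG κ (n + 1))] {e : ℕ}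
    (he : ¬ (((cyclotomic (p ^ (n + 1)) ℤ_[p]).comp (Polynomial.X + 1) : ℤ_[p][X]) : PowerSeries ℤ_[p]) ^ (e + 1) ∣ f) :
    (W.baseChange (κ.layer (n + 1))).selmerCorank p - (W.baseChange (κ.layer n)).selmerCorank p ≤ p ^ n * (p - 1) * e := by
  rw [selmerCorank_layer_succ_eq_add_of_finite_kerG W κ hγ D n, add_tsub_cancel_left]
  exact lambdaInvariant_cyclotomicFactor_le_of_not_pow_dvd p D.X hD hf n he

/-- **UNCONDITIONAL form**: `corank Sel_{p^∞}(E_{K_{n+1}}/K_{n+1}) ≤ rank_{ℤ_p} X/ω_nX + φ(p^{n+1}) · e` whenever `Ψ_{n+1}^{e+1} ∤ f_X`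
(Lemma 3.1 at layer `n+1` only). [cite: GreenbergLNM1716, §3 Lemma 3.1, §5 p. 132] -/
theorem selmerCorank_layer_succ_le_add_of_not_pow_dvd (hγ : κ.IsTopGenerator γ) (D : W.SelmerDualData κ γ)
    [Module.Finite (IwasawaAlgebra p) D.X] (hD : D.IsTorsion) {f : IwasawaAlgebra p} (hf : D.charIdeal = Ideal.span {f}) (n : ℕ)
    {e : ℕ} (he : ¬ (((cyclotomic (p ^ (n + 1)) ℤ_[p]).comp (Polynomial.X + 1) : ℤ_[p][X]) : PowerSeries ℤ_[p]) ^ (e + 1) ∣ f) :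
    (W.baseChange (κ.layer (n + 1))).selmerCorank p ≤
      lambdaInvariant p (D.X ⧸ (Ideal.span {((1 + PowerSeries.X : PowerSeries ℤ_[p]) ^ (p ^ n) - 1 : IwasawaAlgebra p)} •
        ⊤ : Submodule (IwasawaAlgebra p) D.X)) + p ^ n * (p - 1) * e :=
  (selmerCorank_layer_succ_le W κ hγ D n).trans
    (Nat.add_le_add_left (lambdaInvariant_cyclotomicFactor_le_of_not_pow_dvd p D.X hD hf n he) _)

end Selmer

/-! ## §3 `p = 2`: `corank Sel_{2^∞}(W⁽²⁾/ℚ) ≤ rank_{ℤ₂} X/(T+2)X ≤ ord_{T+2} f_X` -/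

section Two

/-- **`Ψ_1 = T + 2` in `Λ` at `p = 2`** (`Φ_2 = X + 1`, `Φ_2(1+T) = T + 2`). [folklore] -/
theorem coe_cyclotomicLayer_two_zero :
    (((cyclotomic (2 ^ (0 + 1)) ℤ_[2]).comp (Polynomial.X + 1) : ℤ_[2][X]) : PowerSeries ℤ_[2]) = PowerSeries.X + 2 := by
  rw [zero_add, pow_one, Polynomial.cyclotomic_two, Polynomial.add_comp, Polynomial.X_comp, Polynomial.one_comp, Polynomial.coe_add,
    Polynomial.coe_add, Polynomial.coe_X, Polynomial.coe_one, add_assoc, one_add_one_eq_two]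

/-- `∑_{i<2} ((1+T)^{2⁰})^i = T + 2` (the `…SelmerLayerSplit` spelling of `Ψ_1` at `p = 2`). [folklore] -/
theorem sum_range_two_pow_eq_X_add_two :
    (∑ i ∈ Finset.range 2, ((1 + PowerSeries.X : PowerSeries ℤ_[2]) ^ (2 ^ 0)) ^ i : IwasawaAlgebra 2) = PowerSeries.X + 2 := by
  rw [← coe_cyclotomicLayer_eq_sum 2 0, coe_cyclotomicLayer_two_zero]

variable (W : WeierstrassCurve ℚ) [W.IsElliptic] [W.IsGloballyMinimal] {κ : ZpExtension ℚ 2} {γ : Field.absoluteGaloisGroup ℚ}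

/-- ★★ **`rank_{ℤ₂} X/(T+2)X ≤ e` whenever `(T+2)^{e+1} ∤ f_X`** (`X = D.X` over any number field would do; here the lineage's setting: any
`ℤ₂`-extension datum with `X` f.g. torsion, `char_Λ X = (f_X)`). [cite: Washington1997, §13.2] -/
theorem lambdaInvariant_quotient_X_add_two_le_of_not_pow_dvd {K : Type u} [Field K] [NumberField K] {W : WeierstrassCurve K}
    {κ : ZpExtension K 2} {γ : Field.absoluteGaloisGroup K} (D : W.SelmerDualData κ γ) [Module.Finite (IwasawaAlgebra 2) D.X]
    (hD : D.IsTorsion) {f : IwasawaAlgebra 2} (hf : D.charIdeal = Ideal.span {f}) {e : ℕ}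
    (he : ¬ (PowerSeries.X + 2 : IwasawaAlgebra 2) ^ (e + 1) ∣ f) :
    lambdaInvariant 2 (D.X ⧸ (Ideal.span {(PowerSeries.X + 2 : IwasawaAlgebra 2)} • ⊤ : Submodule (IwasawaAlgebra 2) D.X)) ≤ e := by
  have he' : ¬ (((cyclotomic (2 ^ (0 + 1)) ℤ_[2]).comp (Polynomial.X + 1) : ℤ_[2][X]) : PowerSeries ℤ_[2]) ^ (e + 1) ∣ f := by
    rwa [coe_cyclotomicLayer_two_zero]
  have h := lambdaInvariant_cyclotomicFactor_le_of_not_pow_dvd 2 D.X hD hf 0 he'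
  have e2 : Ideal.span {(∑ i ∈ Finset.range 2, ((1 + PowerSeries.X : PowerSeries ℤ_[2]) ^ (2 ^ 0)) ^ i : IwasawaAlgebra 2)} •
      (⊤ : Submodule (IwasawaAlgebra 2) D.X) = Ideal.span {(PowerSeries.X + 2 : IwasawaAlgebra 2)} • ⊤ := by
    rw [sum_range_two_pow_eq_X_add_two]
  rw [lambdaInvariant_eq_of_linearEquiv (Submodule.quotEquivOfEq _ _ e2)] at h
  simpa using h

/-- ★★ **`corank_{ℤ₂} Sel_{2^∞}(W⁽²⁾/ℚ) ≤ e` whenever `(T+2)^{e+1} ∤ f_X`** (`W/ℚ` globally minimal, good ordinary at `2`, `κ` cyclotomic,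
`X` torsion), through the sandwich `corank Sel_{2^∞}(W⁽²⁾/ℚ) ≤ rank_{ℤ₂} X/(T+2)X ≤ ord_{T+2} f_X`
(`…SelmerLayerTwoSidedMatching.selmerCorank_quadraticTwist_le_lambdaInvariant_quotient_X_add_two` and §1): g38's `(T+2)^{corank} ∣ f_X`
with the rank of `X/(T+2)X` in between. [cite: DokchitserDokchitserAnnals2010, Lemma 4.14] [cite: GreenbergLNM1716, §1 p. 65] -/
theorem selmerCorank_quadraticTwist_le_of_not_pow_dvd (h2 : IsOrdinaryAt W 2) (hκ : κ.IsCyclotomic) (hγ : κ.IsTopGenerator γ)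
    (D : W.SelmerDualData κ γ) (hD : D.IsTorsion) {f : IwasawaAlgebra 2} (hf : D.charIdeal = Ideal.span {f}) {e : ℕ}
    (he : ¬ (PowerSeries.X + 2 : IwasawaAlgebra 2) ^ (e + 1) ∣ f) :
    (W.quadraticTwist 2).selmerCorank 2 ≤ e := by
  haveI : Module.Finite (IwasawaAlgebra 2) D.X := SelmerDualData.module_finite_of_isCyclotomic W κ hκ D hγ
  exact (selmerCorank_quadraticTwist_le_lambdaInvariant_quotient_X_add_two W h2 hκ hγ D).trans
    (lambdaInvariant_quotient_X_add_two_le_of_not_pow_dvd D hD hf he)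

end Two

end Summit.BirchSwinnertonDyer.BirchSwinnertonDyer.Theorems.AlignedTransportAtTwoSelmerLayerMultiplicity

end
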